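import Literature.Topology.FourManifolds.HopfFibrationProofs
import Literature.Topology.FourManifolds.HopfGreatSphereOrbits
import HarnessLib

/-!
# The Hopf orbits are great 3-spheres: discharge of
`Literature.Topology.FourManifolds.ExistsHopfActionS7GreatOrbits`

Sibling proof file of `HopfGreatSphereOrbits.lean` (D-0014): the named fact
`def ExistsHopfActionS7GreatOrbits : Prop := ∃ (a : FreeS3ActionS7) (π : 𝕊⁷ → 𝕊⁴), a.IsOrbitMap 𝕊⁴ π ∧
IsSmoothGreatSphereFibration π` (Hatcher (2002), §4.2 Example 4.46; Steenrod (1951), §20) is proved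
here as the theorem `ExistsHopfActionS7GreatOrbits_holds`, on top of the explicit quaternionic Hopf
fibration of `HopfFibrationProofs.lean` (`HopfFibration.hopfAction`, `HopfFibration.hopfMap`,
`HopfFibration.isOrbitMap_hopfMap`, which already give smoothness, surjectivity, submersivity and
fibres = orbits).

The one new point is the great-sphere clause of
`Literature.Geometry.Riemannian.IsSmoothGreatSphereFibration`: for `x = (u, v) ∈ S⁷` the fibre
`π ⁻¹ {π x}` — the orbit `{(q u, q v) : |q| = 1}` — is the unit sphere of the real 4-plane
`ℍ·(u, v) ⊆ ℝ⁸`, the range of the `ℝ`-linear map `q ↦ (q u, q v)`, which is injective because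
`|(q u, q v)|² = |q|² (|u|² + |v|²) = |q|²` (`GreatOrbits.exists_fibrePlane`; the plane is produced
inside the proof, no definition is introduced). Theorems only; no `sorry`, no new named fact.

## References

* A. Hatcher, *Algebraic Topology*, Cambridge Univ. Press (2002), §4.2 Example 4.46 (the quaternionic
  Hopf bundle `S³ → S⁷ → S⁴ = ℍP¹`: fibres are the unit spheres of the quaternionic lines). [HatcherAT2002]
* N. Steenrod, *The Topology of Fibre Bundles* (1951), §20. [Steenrod1951]
* H. Gluck, F. Warner, C. T. Yang, Duke Math. J. 50 (1983) 1041–1076; H. Hähl, Results Math. 12 (1987)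
  99–118 (context: fibrations of spheres by great subspheres; tree
  `Literature.Geometry.Riemannian.GreatSphereFibrationsHahl`).
-/

noncomputable section

open scoped Manifold ContDiff Quaternion Topology
open Function Set Quaternion
namespace Literature.Topology.FourManifolds

namespace HopfFibration

namespace GreatOrbits

/-! ## Coordinate algebra (re-proved here: the sibling file keeps its plumbing lemmas private) -/

/-- `fstQ (u, v) = u`. [folklore] -/
private theorem fstQ_pairVec_eq (u v : ℍ) : fstQ (pairVec u v) = u := by
  ext <;> simp [fstQ, pairVec]

/-- `sndQ (u, v) = v`. [folklore] -/
private theorem sndQ_pairVec_eq (u v : ℍ) : sndQ (pairVec u v) = v := by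
  ext <;> simp [sndQ, pairVec]

/-- `(fstQ x, sndQ x) = x`. [folklore] -/
private theorem pairVec_fstQ_sndQ_eq (x : EuclideanSpace ℝ (Fin 8)) : pairVec (fstQ x) (sndQ x) = x := by
  ext i
  fin_cases i <;> rfl

/-- `‖(u, v)‖² = |u|² + |v|²`. [folklore] -/
private theorem norm_sq_pairVec_eq (u v : ℍ) : ‖pairVec u v‖ ^ 2 = normSq u + normSq v := by
  simp only [EuclideanSpace.real_norm_sq_eq, Fin.sum_univ_eight, pairVec, normSq_def']
  simp
  ring

/-- `pairVec` is additive. [folklore] -/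
private theorem pairVec_add (a b c d : ℍ) : pairVec (a + b) (c + d) = pairVec a c + pairVec b d := by
  ext i
  fin_cases i <;> simp [pairVec]

/-- `pairVec` is homogeneous. [folklore] -/
private theorem pairVec_smul (r : ℝ) (a c : ℍ) : pairVec (r • a) (r • c) = r • pairVec a c := by
  ext i
  fin_cases i <;> simp [pairVec]

/-! ## The orbit 4-plane `ℍ·(u, v)` -/

/-- **The Hopf orbits are great 3-spheres**: for `x = (u, v) ∈ S⁷` the fibre of the Hopf map through
`x` — the orbit `{(q u, q v) : |q| = 1}` — is the unit sphere of the real 4-plane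
`ℍ·(u, v) = {(q u, q v) : q ∈ ℍ} ⊆ ℝ⁸`, the range of the injective `ℝ`-linear map `q ↦ (q u, q v)`
(Hatcher (2002), Example 4.46: the fibres of `S⁴ⁿ⁺³ → ℍPⁿ` are the unit spheres of the quaternionic
lines). [cite: HatcherAT2002, §4.2 Example 4.46] -/
theorem exists_fibrePlane (x : Metric.sphere (0 : EuclideanSpace ℝ (Fin (7 + 1))) 1) :
    ∃ V : Submodule ℝ (EuclideanSpace ℝ (Fin 8)), Module.finrank ℝ V = 4 ∧
      hopfMap ⁻¹' {hopfMap x} =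
        {y : Metric.sphere (0 : EuclideanSpace ℝ (Fin (7 + 1))) 1 | (y : EuclideanSpace ℝ (Fin 8)) ∈ V} := by
  -- the linear map `q ↦ (q u, q v)`
  let L : ℍ →ₗ[ℝ] EuclideanSpace ℝ (Fin 8) :=
    { toFun := fun q ↦ actVec q (x : EuclideanSpace ℝ (Fin 8))
      map_add' := fun a b ↦ by simp only [actVec, add_mul, pairVec_add]
      map_smul' := fun r a ↦ by simp only [actVec, smul_mul_assoc, pairVec_smul, RingHom.id_apply] }
  have hL : ∀ q : ℍ, L q = actVec q (x : EuclideanSpace ℝ (Fin 8)) := fun q ↦ rfl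
  have hx1 : normSq (fstQ (x : EuclideanSpace ℝ (Fin 8))) + normSq (sndQ (x : EuclideanSpace ℝ (Fin 8))) = 1 := by
    rw [← norm_sq_pairVec_eq, pairVec_fstQ_sndQ_eq, norm_eq_of_mem_sphere x, one_pow]
  -- `|q • x|² = |q|²`
  have hnorm : ∀ q : ℍ, ‖actVec q (x : EuclideanSpace ℝ (Fin 8))‖ ^ 2 = normSq q := by
    intro q
    rw [actVec, norm_sq_pairVec_eq, map_mul, map_mul, ← mul_add, hx1, mul_one]
  -- injectivity
  have hinj : Function.Injective L := by
    rw [← LinearMap.ker_eq_bot, LinearMap.ker_eq_bot']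
    intro q hq
    have h0 : ‖actVec q (x : EuclideanSpace ℝ (Fin 8))‖ ^ 2 = 0 := by rw [← hL, hq, norm_zero, zero_pow two_ne_zero]
    rw [hnorm] at h0
    exact normSq_eq_zero.1 h0
  refine ⟨LinearMap.range L, ?_, ?_⟩
  · rw [LinearMap.finrank_range_of_inj hinj, Quaternion.finrank_eq_four]
  · ext y
    simp only [Set.mem_preimage, Set.mem_singleton_iff, Set.mem_setOf_eq, LinearMap.mem_range]
    constructor
    · intro hy
      obtain ⟨q, hq⟩ := exists_act_eq_of_hopfMap_eq hy.symm
      exact ⟨(q : ℍ), by rw [hL, ← hq, coe_act]⟩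
    · rintro ⟨q, hq⟩
      rw [hL] at hq
      have hq1 : ‖q‖ = 1 := by
        have h1 : ‖actVec q (x : EuclideanSpace ℝ (Fin 8))‖ ^ 2 = 1 := by
          rw [hq, norm_eq_of_mem_sphere y, one_pow]
        rw [hnorm, normSq_eq_norm_mul_self, ← sq] at h1
        exact (pow_eq_one_iff_of_nonneg (norm_nonneg _) two_ne_zero).1 h1
      have hy : act ⟨q, mem_sphere_zero_iff_norm.2 hq1⟩ x = y := Subtype.ext (by rw [coe_act]; exact hq)
      rw [← hy, hopfMap_act]

end GreatOrbits

/-- **The Hopf map is a smooth great-3-sphere fibration of `S⁷`** in the sense of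
`Literature.Geometry.Riemannian.IsSmoothGreatSphereFibration` (smooth, surjective, submersive —
`isOrbitMap_hopfMap` — with great-3-sphere fibres, `GreatOrbits.exists_fibrePlane`).
[cite: HatcherAT2002, §4.2 Example 4.46] -/
theorem isSmoothGreatSphereFibration_hopfMap :
    Literature.Geometry.Riemannian.IsSmoothGreatSphereFibration hopfMap :=
  ⟨isOrbitMap_hopfMap.1, isOrbitMap_hopfMap.2.1, isOrbitMap_hopfMap.2.2.1, GreatOrbits.exists_fibrePlane⟩

end HopfFibration

/-- **Discharge of the named fact `ExistsHopfActionS7GreatOrbits`** (Hatcher (2002), §4.2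
Example 4.46; Steenrod (1951), §20): the quaternionic Hopf action (`HopfFibration.hopfAction`) is a
free smooth `S³`-action on `S⁷` whose orbit map, the Hopf map `HopfFibration.hopfMap : S⁷ → S⁴`, is an
orbit map onto the standard `S⁴` (`HopfFibration.isOrbitMap_hopfMap`) AND a smooth great-3-sphere
fibration (`HopfFibration.isSmoothGreatSphereFibration_hopfMap`: the orbit of `(u, v)` is the unit
sphere of the real 4-plane `ℍ·(u, v)`). [cite: HatcherAT2002, §4.2 Example 4.46] -/
theorem ExistsHopfActionS7GreatOrbits_holds : ExistsHopfActionS7GreatOrbits :=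
  ⟨HopfFibration.hopfAction, HopfFibration.hopfMap, HopfFibration.isOrbitMap_hopfMap,
    HopfFibration.isSmoothGreatSphereFibration_hopfMap⟩

end Literature.Topology.FourManifolds
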